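import Mathlib.Analysis.InnerProductSpace.GramSchmidtOrtho
import Mathlib.Analysis.Asymptotics.Defs
import Mathlib.Analysis.SpecialFunctions.Log.Basic
import Mathlib.Data.Nat.Sqrt
import Literature.Algebra.EuclideanLattices.Problems
import Literature.Algebra.EuclideanLattices.Encoding
import Literature.Computability.Cryptography.LWE
import Literature.Computability.Cryptography.LWENoise
import Literature.Computability.Cryptography.PQCLWE
import Literature.Algebra.EuclideanLattices.LatticeComplexity
import Literature.Computability.Complexity.BoolEncodings
import Literature.Computability.Complexity.Oracle
import Literature.Computability.Cryptography.OracleGames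
import Literature.Computability.Cryptography.QuantumCircuit
import Literature.Computability.Cryptography.ClassBQP
import HarnessLib
import HarnessLib.Audit

-- provenance: harness21/H21/H21/Statements/PQC/LWEHardness.lean @ 1a97641 (interim HEAD d8f2665); M5 mechanical rewrite
/-!
# Hardness of Learning With Errors (family `pqc`, trunk T-LATTICE, item `PQCLWEHardness`)

Namespace `Literature.PQC` (glue on G01's oracle model in `Literature.CplxCore`, as deliberate dot-notation
extensions of `OracleAlg` / `Oracle`). This statement file realises

* **pqc.S01** `LWENotInBQP` (peak; negation form of summits/fw-lwe-bqp; POSED in Regev 2009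
  §1) and **pqc.S02** `LWEInBQP` (its negation) — their unfoldings `lweNotInBQP_iff`,
  `lweInBQP_iff_not_lweNotInBQP` now live in `LWEHardnessConsequences.lean`, stated over the
  canonical conjecture leaves `Summit.PneNP.PneNP.LWENotInBQP` / `Summit.PneNP.PneNP.LWEInBQP`
  (conjecture/notion split 2026-08-15): both are registered OPEN CONJECTURES (`def … : Prop` whose docstrings read `OPEN CONJECTURE — …
  [status: open]`, CONVENTIONS §4), not literature debt — no `_holds` discharge is expected for
  either (defact verdict clean-up 2026-08-15: Regev 2009 proves neither direction; names kept
  for their users);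
* **pqc.S19** `regev_lwe_to_sivp_quantum`, `regev_lwe_to_gapSVP_quantum` (Regev 2009,
  Thm 1.1 / 3.1: quantum reduction from `SIVP_{Õ(n/α)}` / `GapSVP_{Õ(n/α)}` to `LWE_{q,Ψ̄_α}`,
  `αq > 2√n`);
* **pqc.S20** `peikert_gapSVPZeta_to_lwe_classical` (Peikert STOC 2009, Thm 3.1: classical
  reduction from `GapSVP_{ζ,γ}` for large `q`);
* **pqc.S21** `blprs_gapSVP_sqrt_dim_to_lwe_classical` (BLPRS STOC 2013, Thm 1.1: classical
  hardness of `n`-dim LWE with polynomial modulus from `√n`-dim `GapSVP`);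
* **pqc.S22** `regev_decision_to_search`, `regev_search_to_decision` (Regev 2009,
  Lemmas 4.1–4.2: search/decision equivalence for prime `q = poly(n)`).

## Quantum machine model (G11)

Polynomial-time quantum algorithms are G11's circuit families
`Literature.CryptoQuantFine.QCircuitFamily cliffordT` that are oracle-free and poly-time uniform
(`IsOracleFree`, `IsUniform`), with the classical kernel semantics
`QCircuitFamily.kernel 0 : List Bool → PMF (List Bool)` and `kernelProb` (empty oracle
`0 : Language Bool`), exactly as in G11's `BQP`/`IsQSolvable`. For the `∀ Q`/`∃ Q`-shaped
statements here (and of the sibling `RingLWE.lean`) the two side conditions are bundled once as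
the subtype-like structure `UniformQCircuitFamily` (thin glue, no new semantics), with
`UniformQCircuitFamily.kernel Q := Q.family.kernel 0` and
`UniformQCircuitFamily.acceptProb Q := Q.family.acceptProbOn 0` (wire `0`, thresholds
`2/3`–`1/3` exactly as in G11's `PromiseBQP`).

## Randomised oracle algorithms (G11 `OracleGames`)

The randomised runner `Literature.CplxCore.OracleAlg.randRun M O coins fuel x : PMF (Option β)` (G01's
deterministic `OracleAlg` run on `boolPair x coins`, coins uniform on
`{0,1}^{coins |x|}`, `fuel |x|` rounds; polynomial time is `OracleAlg.IsPolyTime`) is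
IMPORTED from its canonical home `Literature.Prelude.CryptoQuantFine.OracleGames` and not redeclared
here (this attempt removes the former local copy, which clashed on co-import).

## Local glue (outline finding 3; candidates for upstreaming)

* Encoders/decoders `encodeLWESamples`, `encodeSecret`, `decodeSecret` (total, junk `0`,
  prefix-tolerant), `decodeIntMatrix`, built from G01's `boolPair`, `encodingFinVec`,
  `pairBool` and Mathlib's `encodingNatBool` (residues via `ZMod.val`).
* Semantic predicates on G01's deterministic oracles `Oracle := List Bool → List Bool`:
  `Oracle.searchLWEKernel`, `Oracle.SolvesSearchLWE` (:= `SearchLWESolves` of the kernel),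
  `Oracle.lweDistinguisherKernel`, `Oracle.lweAdvantage`. MODELLING CHOICE: LWE oracles are
  deterministic; a randomised LWE solver is covered by adjoining its coins to the query, which
  the (randomised) reduction samples itself.
* Peikert's `GapSVPZeta.yes/no ζ γ` (moved here from `Problems.lean`, finding 6b), with the
  Gram–Schmidt condition through Mathlib's `InnerProductSpace.gramSchmidt`.
* Growth glue `IsSoftBigO γ f` (`γ = Õ(f)`, via Mathlib's `Asymptotics.IsBigO`; generic,
  upstreaming candidate if other families need `Õ`). Polynomial bounds on real sequences use
  the shared `Literature.Algebra.EuclideanLattices.IsPolyBoundedReal` of the sibling `Statements/PQC/LatticeComplexity.lean`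
  (imported, not redeclared).
* Uniformity glue `IsPolyTimeParams q α m` (parameters poly-time computable from `1ⁿ`, `α`
  through a rational sequence; G01 `PolyTimeComputable`, Mathlib `unaryEncodeNat`/`encodeNat`,
  `Literature.Algebra.EuclideanLattices.encodeRat`): the implicit hypothesis of Regev/Peikert/BLPRS that makes a single
  uniform reduction meaningful (S19–S21; review finding 1 of attempt 2).

## Mathlib

Used: `PMF`, `PMF.map`, `PMF.pure`, `PMF.uniformOfFintype`, `PMF.toOuterMeasure`,
`Asymptotics.IsBigO`, `Real.log`, `InnerProductSpace.gramSchmidt`, `Computability.Encoding`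
(+ `encodingNatBool`, `unaryEncodeNat`, `encodingBoolBool`, `encodingList`), `Nat.sqrt`,
`Filter.atTop`, `Filter.Frequently`. Mathlib has no LWE, no lattice promise problems and no
oracle/quantum complexity (searched `LWE`, `GapSVP`, `BQP`, `oracle`); quantum circuits come
from H21's G11 (`Literature.Prelude.CryptoQuantFine.QuantumCircuit`/`ClassBQP`).

## Design notes (vacuity audit, faithfulness flags)

* All success hypotheses/conclusions on LWE are phrased through the accepted asymptotic
  predicates `SearchLWESolves`/`DecisionLWEDistinguishes` (`Statements/PQC/LWE.lean`), whose
  thresholds sit under `∀ᶠ n in atTop`; S01 is literally `¬ SearchLWESolves … (2/3)`, i.e.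
  `∃ᶠ n, Pr < 2/3` (`lweNotInBQP_iff`). Success thresholds `1 - 1/n^{c'}` are quantified
  `∀ c'`.
* Approximation factors produced by the reductions carry the lower bound `∀ n, 1 ≤ γ n`
  (Regev/Peikert/BLPRS all have `γ ≥ 1`); without it S20 would be vacuous (`γ = 0` empties
  Peikert's promise `d ≤ ζ/γ` through `x / 0 = 0`).
* S01 uses the summit's `αq ≥ 2√n` (inside `RegevRegime`), S19 Regev's strict `αq > 2√n`.
* S19/S20/S21 (uniformity): the conclusions provide ONE uniform reduction (a G11 family, resp.
  one `OracleAlg` with polynomial coins/fuel) whose only input is a lattice instance; it must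
  produce `q n`, `m n` and sample `Ψ̄_{α n}` itself. Hence the hypothesis
  `IsPolyTimeParams q α m` (implicit in the papers); without it the statements would claim a
  fixed machine handles non-computable parameter sequences (false under the very hardness
  beliefs of this family). S01/S02/S22 need no such hypothesis: there the machines read
  `n, q, m` off the self-describing `encodeLWESamples` header and never sample the noise.
* S20: Peikert's modulus condition `q ≥ ζ · ω(√(log n / n))` is stated exactly: one reduction
  for every `f → ∞` with `q n ≥ ζ n · f n · √(log n) / √n` eventually; `q` is NOT assumed
  polynomially bounded (exponential moduli are the point), but `IsPolyTimeParams` gives it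
  polynomially many bits (binary `encodeNat`), as a poly(n)-time reduction requires; theorem
  numbers of Peikert 2009 / BLPRS 2013 carry the inventory's `?`.
* S21: BLPRS's noise lower bound (`αq ≥ √n ·` log-factors, exact form `?`) is quantified as
  `∃ k, ∀ α, (∀ᶠ n, √n (log n)^k ≤ α n q n) → …` instead of hard-coding a constant; `q`, `γ`
  polynomial, `GapSVP` dimension `⌊√n⌋`.
* S19 (GapSVP form) uses G11's `acceptProbOn 0` with `≥ 2/3` on YES and `≤ 1/3` on NO
  instances, textually as G11's `PromiseBQP`.
* S22: `distinguishingAdvantage` is average-case in `s`; Regev's Lemma 4.1 passes through a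
  worst-case / non-negligible-fraction-of-`s` distinguisher (recorded in the docstring). The
  `∀ c, ∀ᶠ n, · ≤ 1/n^c` idiom is T-CRYPTO's `Negligible` (Mathlib anchor
  `Asymptotics.SuperpolynomialDecay`), to be substituted once it is shared. The easy direction
  assumes `q n ≥ 2` eventually (for `q = 1` LWE and uniform samples coincide and the statement
  is false); `hprime` is eventual too.
* Naming: `Oracle.SolvesSearchLWE` keeps the outline's planned (verb-phrase) name rather than an
  `Is…` predicate name, matching the accepted `SearchLWESolves`/`DecisionLWEDistinguishes` it
  unfolds to.
* Decision procedures with output `Option Bool` (`randRun`, timeouts are `none`) must answer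
  `some true` on YES and `some false` on NO instances; quantum deciders accept iff the first
  measured wire reads `1` (G11's `acceptProbOn`, wire `0`); oracle answer strings are read with
  `IsAccepting` (first bit `1`). `Accepts` is a plain alias of `IsAccepting` kept only for the
  sibling `RingLWE.lean` (to be removed once that file says `IsAccepting`).
* Junk values: `decodeSecret`/`decodeIntMatrix` return `0` on malformed words.
* Used from Mathlib in addition: `Filter.Tendsto` (Peikert's `ω(·)`), `Real.sqrt`, `Real.log`,
  `Computability.unaryEncodeNat`/`encodeNat` (uniformity glue).

## References

* O. Regev, *On lattices, learning with errors, random linear codes, and cryptography*, J. ACM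
  56(6) (2009), art. 34, doi:10.1145/1568318.1568324; arXiv:2401.03703 — §1 (pp. 3–4 of the
  arXiv version: the quantum-hardness CONJECTURE behind `LWENotInBQP`/`LWEInBQP`, read
  2026-08-15), Thm 1.1, Thm 3.1, §4 (Lemmas 4.1–4.2).
* C. Peikert, *Public-key cryptosystems from the worst-case shortest vector problem*, STOC 2009,
  §3, Thm 3.1.
* Z. Brakerski, A. Langlois, C. Peikert, O. Regev, D. Stehlé, *Classical hardness of learning
  with errors*, STOC 2013, Thm 1.1.
* E. Bernstein, U. Vazirani, *Quantum complexity theory*, SIAM J. Comput. 26 (1997), §8.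
* S. Arora, B. Barak, *Computational Complexity: A Modern Approach*, CUP 2009, §0.1, Def. 10.9.
* summits/fw-lwe-bqp/SUMMIT.md.
-/

noncomputable section

open Filter Asymptotics Computability Literature.Computability.Complexity Literature.Computability.Cryptography.LWE Literature.Algebra.EuclideanLattices Literature.Computability.Cryptography
open scoped ENNReal

namespace Literature.Computability.Cryptography

section PQC

/-! ### Uniform polynomial-time quantum circuit families (bundled G11 data) -/

/-- A *polynomial-time uniform quantum circuit family*: a G11 circuit family over Clifford+T
(`Literature.CryptoQuantFine.QCircuitFamily cliffordT`) that is oracle-free and poly-time uniform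
(`IsOracleFree`, `IsUniform`, hence polynomial-size). This merely bundles the two side
conditions that G11's `BQP`/`IsQSolvable` impose, so that statements can quantify `∀ Q`/`∃ Q`.
[Bernstein–Vazirani 1997, §8; Yao 1993; Arora–Barak 2009, Def. 10.9] [cite: BernsteinVazirani1997, §8] -/
structure UniformQCircuitFamily where
  /-- The underlying G11 circuit family (one circuit on `n + ancillas n` wires per length `n`). -/
  family : QCircuitFamily cliffordT
  /-- No oracle gates. -/
  isOracleFree : family.IsOracleFree
  /-- `1ⁿ ↦ ⟨circ n⟩` is polynomial-time computable (G11 `QCircuitFamily.IsUniform`). -/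
  isUniform : family.IsUniform

namespace UniformQCircuitFamily

/-- The classical kernel `{0,1}* → PMF {0,1}*` of a uniform family: G11's
`QCircuitFamily.kernel` relative to the empty oracle (run `circ |x|` on `|x⟩|0…0⟩`, measure all
wires). [Nielsen–Chuang 2000, §4.5; G11 outline R12] [cite: NielsenChuang2000, §4.5] -/
def kernel (Q : UniformQCircuitFamily) (x : List Bool) : PMF (List Bool) :=
  Q.family.kernel 0 x

/-- The probability (a real number in `[0,1]`) that the classical output of `Q` on `x` lies in
`E`: G11's `QCircuitFamily.kernelProb` relative to the empty oracle. [G11 outline R12] [folklore] -/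
def kernelProb (Q : UniformQCircuitFamily) (x : List Bool) (E : Set (List Bool)) : ℝ :=
  Q.family.kernelProb 0 x E

/-- Unfolding: `Q.kernelProb x E = (Q.kernel x) E` as a real number. [folklore] -/
theorem kernelProb_eq (Q : UniformQCircuitFamily) (x : List Bool) (E : Set (List Bool)) :
    Q.kernelProb x E = ((Q.kernel x).toOuterMeasure E).toReal :=
  rfl

/-- Kernel probabilities are at most `1` (G11 `kernelProb_le_one`). [folklore] -/
theorem kernelProb_le_one (Q : UniformQCircuitFamily) (x : List Bool) (E : Set (List Bool)) :
    Q.kernelProb x E ≤ 1 :=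
  QCircuitFamily.kernelProb_le_one _ _ _ _

/-- The acceptance probability of the decision procedure `Q` on input `x`: G11's
`QCircuitFamily.acceptProbOn` relative to the empty oracle (Born probability that the designated
output wire `0` reads `1`), as in G11's `BQP`/`PromiseBQP`. [Bernstein–Vazirani 1997, §8;
Arora–Barak 2009, Def. 10.9] [cite: BernsteinVazirani1997, §8] -/
def acceptProb (Q : UniformQCircuitFamily) (x : List Bool) : ℝ :=
  Q.family.acceptProbOn 0 x

/-- Unfolding: `Q.acceptProb x = Q.family.acceptProbOn 0 x`. [folklore] -/
theorem acceptProb_eq (Q : UniformQCircuitFamily) (x : List Bool) :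
    Q.acceptProb x = Q.family.acceptProbOn 0 x :=
  rfl

/-- A uniform family has polynomial size (G11 `IsUniform.isPolySize`). [Yao 1993] [cite: Yao1993] -/
def family_isPolySize : Prop :=
  ∀ (Q : UniformQCircuitFamily),
    Q.family.IsPolySize

/- interim proof relied on results that are now named facts (D-0014); demoted to a fact by the M5 import, proof preserved:
:=
  Q.isUniform.isPolySize
-/

/-- A uniform family deciding a promise problem with thresholds `2/3`–`1/3` witnesses membership
in G11's `PromiseBQP` (sanity link between the `∃ Q : UniformQCircuitFamily` statements below
and G11's class). [Arora–Barak 2009, Def. 10.9; G11 `PromiseBQP`] [cite: AroraBarak2009, Def. 10.9] -/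
theorem mem_promiseBQP (P : PromiseProblem) (Q : UniformQCircuitFamily)
    (hyes : ∀ x ∈ P.yes, 2 / 3 ≤ Q.acceptProb x) (hno : ∀ x ∈ P.no, Q.acceptProb x ≤ 1 / 3) :
    P ∈ PromiseBQP :=
  ⟨Q.family, Q.isOracleFree, Q.isUniform, hyes, hno⟩

end UniformQCircuitFamily

/-- A bit string is *accepting* if its first bit is `1` (the designated output wire `0` of a
decision procedure; this is G11's `QCircuit.acceptEvent` read after `List.ofFn`).
[Arora–Barak 2009, Def. 10.9; Bernstein–Vazirani 1997, §8] [cite: AroraBarak2009, Def. 10.9] -/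
def IsAccepting (w : List Bool) : Prop := w.head? = some true

/-- `IsAccepting` is decidable (an equation between `Option Bool`s). [folklore] -/
instance (w : List Bool) : Decidable (IsAccepting w) :=
  inferInstanceAs (Decidable (w.head? = some true))

/-- Alias of `IsAccepting`, kept ONLY for the sibling `RingLWE.lean` (written against the first
version of this file); to be deleted once that file uses `IsAccepting`. Not marked
`@[deprecated]` so that the accepted library elaborates without extra warnings.
[Arora–Barak 2009, Def. 10.9] [cite: AroraBarak2009, Def. 10.9] -/
abbrev Accepts (w : List Bool) : Prop := IsAccepting w

/-! ### Encodings of LWE data (local glue; candidates for upstreaming to `CplxCore`) -/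

section LWEEncodings

variable {n q m : ℕ}

/-- The bit string of a tuple of `m` LWE samples `(aⱼ, bⱼ) ∈ ℤ_qⁿ × ℤ_q`: the header
`boolPair (encodeNat n) (boolPair (encodeNat q) ·)` followed by the `encodingFinVec` code of the
list of pairs, every residue written in binary through its representative `ZMod.val ∈ [0, q)`.
Self-describing (an algorithm reads off `n`, `q`, `m`). [Regev 2009, §2 (input of an LWE
algorithm); Arora–Barak 2009, §0.1] [cite: Regev2009, §2 (input of an LWE algorithm] -/
def encodeLWESamples (S : Fin m → (Fin n → ZMod q) × ZMod q) : List Bool :=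
  boolPair (encodeNat n) (boolPair (encodeNat q)
    ((encodingFinVec ((encodingFinVec encodingNatBool n).pairBool encodingNatBool) m).encode
      fun j => (fun i => ((S j).1 i).val, ((S j).2).val)))

/-- The bit string of a secret `s ∈ ℤ_qⁿ`: `boolPair (code of (s i).val)ᵢ []` (self-delimited,
so that it can be followed by arbitrary further register content). [Regev 2009, §2;
Arora–Barak 2009, §0.1] [cite: Regev2009, §2] -/
def encodeSecret (s : Fin n → ZMod q) : List Bool :=
  boolPair ((encodingFinVec encodingNatBool n).encode fun i => (s i).val) []

variable (n q) in
/-- Total decoder for secrets: read the first `boolPair` component of `w` as the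
`encodingFinVec encodingNatBool n` code of `n` naturals and reduce them modulo `q`; on malformed
words return the JUNK value `0` (documented; only `decodeSecret_encodeSecret_append` is relied
upon). Trailing bits after the separator are ignored, so fixed-width machine outputs (measured
quantum registers) decode correctly. [Arora–Barak 2009, §0.1] [cite: AroraBarak2009, §0.1] -/
def decodeSecret (w : List Bool) : Fin n → ZMod q :=
  match (encodingFinVec encodingNatBool n).decode (boolUnpair w).1 with
  | some v => fun i => (v i : ZMod q)
  | none => 0

/-- `decodeSecret` inverts `encodeSecret`, ignoring any trailing bits. [folklore] -/
@[simp] theorem decodeSecret_encodeSecret_append [NeZero q] (s : Fin n → ZMod q) (w : List Bool) :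
    decodeSecret n q (encodeSecret s ++ w) = s := by
  unfold decodeSecret encodeSecret
  rw [show boolPair ((encodingFinVec encodingNatBool n).encode fun i => (s i).val) [] ++ w =
      boolPair ((encodingFinVec encodingNatBool n).encode fun i => (s i).val) w by
    simp [boolPair], boolUnpair_boolPair, (encodingFinVec encodingNatBool n).decode_encode]
  funext i
  simp

/-- `decodeSecret` inverts `encodeSecret`. [folklore] -/
@[simp] theorem decodeSecret_encodeSecret [NeZero q] (s : Fin n → ZMod q) :
    decodeSecret n q (encodeSecret s) = s := by
  simpa using decodeSecret_encodeSecret_append s []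

/-- `encodeLWESamples` is injective on samples over `ℤ_q`, `q ≠ 0` (residues are determined by
their representatives). [Mathlib `Computability.Encoding.encode_injective`, `ZMod.val_injective`] [folklore] -/
theorem encodeLWESamples_injective [NeZero q] :
    Function.Injective (encodeLWESamples : (Fin m → (Fin n → ZMod q) × ZMod q) → List Bool) := by
  intro S T h
  set e := encodingFinVec ((encodingFinVec encodingNatBool n).pairBool encodingNatBool) m
  set f : (Fin m → (Fin n → ZMod q) × ZMod q) → Fin m → (Fin n → ℕ) × ℕ :=
    fun S j => (fun i => ((S j).1 i).val, ((S j).2).val)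
  have h1 : boolPair (encodeNat q) (e.encode (f S)) = boolPair (encodeNat q) (e.encode (f T)) :=
    (Prod.ext_iff.1 (boolPair_injective (a₁ := (_, _)) (a₂ := (_, _)) h)).2
  have h2 : e.encode (f S) = e.encode (f T) :=
    (Prod.ext_iff.1 (boolPair_injective (a₁ := (_, _)) (a₂ := (_, _)) h1)).2
  have h3 := congr_fun (e.encode_injective h2)
  funext j
  have hj := Prod.ext_iff.1 (h3 j)
  refine Prod.ext (funext fun i => ZMod.val_injective _ (congr_fun hj.1 i)) ?_
  exact ZMod.val_injective _ hj.2

variable (n) in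
/-- Total decoder for integer matrices / tuples of `n` integer vectors (outputs of `SIVP`
algorithms): read the first `boolPair` component of `w` with `encodingIntMatrixFin n`; JUNK
value `0` on malformed words; trailing bits ignored. [Arora–Barak 2009, §0.1] [cite: AroraBarak2009, §0.1] -/
def decodeIntMatrix (w : List Bool) : Fin n → Fin n → ℤ :=
  match (encodingIntMatrixFin n).decode (boolUnpair w).1 with
  | some B => B
  | none => 0

/-- `decodeIntMatrix` inverts the self-delimited matrix code, ignoring trailing bits. [folklore] -/
@[simp] theorem decodeIntMatrix_boolPair (B : Matrix (Fin n) (Fin n) ℤ) (w : List Bool) :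
    decodeIntMatrix n (boolPair ((encodingIntMatrixFin n).encode B) w) = B := by
  unfold decodeIntMatrix
  rw [boolUnpair_boolPair, (encodingIntMatrixFin n).decode_encode]

end LWEEncodings

end PQC

section CplxCore

section Oracle
open Literature.Computability.Complexity (Oracle)
open Literature.Computability.Complexity.Oracle

/-! ### LWE oracles (local glue on G01's `Oracle`; randomised runs are G11's `OracleAlg.randRun`) -/

open Literature.Algebra.EuclideanLattices

/-- LOCAL GLUE. The search-LWE solver (a deterministic Markov kernel) presented by an oracle
`O : {0,1}* → {0,1}*`: query the encoded samples, decode the answer as a secret. Deterministic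
oracles suffice: a randomised LWE solver is covered by adjoining its coins to the query, which
the reduction samples itself (documented modelling choice). Deliberate dot-notation extension of
`Literature.Computability.Complexity.Oracle`. [Regev 2009, §4; Peikert 2009, §3] [cite: Regev2009, §4] -/
def _root_.Literature.Computability.Complexity.Oracle.searchLWEKernel (O : Oracle) (n q m : ℕ) : Solver (Fin n) (ZMod q) m :=
  fun S => PMF.pure (decodeSecret n q (O (encodeLWESamples S)))

/-- LOCAL GLUE. `O.SolvesSearchLWE q χ m p`: the oracle `O` solves search-`LWE_{q(n),χ(n)}` from
`m n` samples with (average-case over uniform `s`) success probability at least `p`, for all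
large `n` (this is `Literature.Computability.Cryptography.SearchLWESolves` for the kernel `O.searchLWEKernel`).
[Regev 2009, §4; Peikert 2009, Thm 3.1 (hypothesis "an algorithm solving LWE")] [cite: Regev2009, §4] -/
def _root_.Literature.Computability.Complexity.Oracle.SolvesSearchLWE (O : Oracle) (q : ℕ → ℕ) [∀ n, NeZero (q n)] (χ : ∀ n, PMF (ZMod (q n)))
    (m : ℕ → ℕ) (p : ℝ) : Prop :=
  SearchLWESolves q χ m (fun n => O.searchLWEKernel n (q n) (m n)) fun _ => p

/-- Unfolding lemma: `O.SolvesSearchLWE q χ m p` says that eventually in `n` the deterministic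
solver `S ↦ decodeSecret (O (encodeLWESamples S))` succeeds with probability `≥ p`.
[Regev 2009, §4] [cite: Regev2009, §4] -/
theorem _root_.Literature.Computability.Complexity.Oracle.solvesSearchLWE_iff (O : Oracle) (q : ℕ → ℕ) [∀ n, NeZero (q n)]
    (χ : ∀ n, PMF (ZMod (q n))) (m : ℕ → ℕ) (p : ℝ) :
    O.SolvesSearchLWE q χ m p ↔ ∀ᶠ n in atTop,
      ENNReal.ofReal p ≤ searchSuccessProb (χ n) (m n) (O.searchLWEKernel n (q n) (m n)) :=
  Iff.rfl

/-- LOCAL GLUE. The decision-LWE distinguisher presented by an oracle: query the encoded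
samples and accept iff the answer string is accepting (first bit `1`). Deliberate dot-notation
extension of `Literature.Computability.Complexity.Oracle`. [Regev 2009, §4, Lemmas 4.1–4.2] [cite: Regev2009, §4  Lemmas 4.1–4.2] -/
def _root_.Literature.Computability.Complexity.Oracle.lweDistinguisherKernel (O : Oracle) (n q m : ℕ) : Distinguisher (Fin n) (ZMod q) m :=
  fun S => PMF.pure (decide (IsAccepting (O (encodeLWESamples S))))

/-- LOCAL GLUE. `O.lweAdvantage q χ m n`: the (average-case) decision-LWE advantage of the
oracle `O` against `LWE_{q(n),χ(n)}` with `m n` samples in dimension `n`.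
[Regev 2009, §4; Peikert 2016, Def. 4.2.2] [cite: Regev2009, §4] -/
def _root_.Literature.Computability.Complexity.Oracle.lweAdvantage (O : Oracle) (q : ℕ → ℕ) [∀ n, NeZero (q n)] (χ : ∀ n, PMF (ZMod (q n)))
    (m : ℕ → ℕ) (n : ℕ) : ℝ :=
  distinguishingAdvantage (χ n) (m n) (O.lweDistinguisherKernel n (q n) (m n))

/-- The accepted asymptotic predicate `DecisionLWEDistinguishes` for the oracle's distinguisher
is the eventual lower bound on `O.lweAdvantage`. [Regev 2009, §4] [cite: Regev2009, §4] -/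
theorem _root_.Literature.Computability.Complexity.Oracle.decisionLWEDistinguishes_iff (O : Oracle) (q : ℕ → ℕ) [∀ n, NeZero (q n)]
    (χ : ∀ n, PMF (ZMod (q n))) (m : ℕ → ℕ) (adv : ℕ → ℝ) :
    DecisionLWEDistinguishes q χ m (fun n => O.lweDistinguisherKernel n (q n) (m n)) adv ↔
      ∀ᶠ n in atTop, adv n ≤ O.lweAdvantage q χ m n :=
  Iff.rfl

end Oracle

end CplxCore

section PQC

/-! ### Solvers presented by quantum families and by randomised oracle algorithms -/

/-- The search-LWE solver computed by a uniform quantum family in dimension `n`: feed the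
encoded samples, decode the measured register as a secret. [Regev 2009, §1 (quantum LWE
solvers); Arora–Barak 2009, Def. 10.9] [cite: Regev2009, §1 (quantum LWE solvers] -/
def UniformQCircuitFamily.searchLWESolver (Q : UniformQCircuitFamily) (n q m : ℕ) :
    Solver (Fin n) (ZMod q) m :=
  fun S => (Q.kernel (encodeLWESamples S)).map (decodeSecret n q)

/-- The search-LWE solver computed by the randomised oracle algorithm `M` (string output) with
oracle `O`: run `M.randRun O coins fuel` on the encoded samples and decode the output as a
secret (a timeout `none` decodes to the junk secret `0`). [Regev 2009, §4, Lemma 4.2] [cite: Regev2009, §4  Lemma 4.2] -/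
def oracleSearchLWESolver (M : OracleAlg (List Bool)) (O : Oracle) (coins fuel : Polynomial ℕ)
    (n q m : ℕ) : Solver (Fin n) (ZMod q) m :=
  fun S => (M.randRun O coins fuel (encodeLWESamples S)).map fun o => decodeSecret n q (o.getD [])

/-- The decision-LWE distinguisher computed by the randomised oracle algorithm `M` (Boolean
output) with oracle `O` (a timeout `none` counts as rejection). [Regev 2009, §4] [cite: Regev2009, §4] -/
def oracleLWEDistinguisher (M : OracleAlg Bool) (O : Oracle) (coins fuel : Polynomial ℕ)
    (n q m : ℕ) : Distinguisher (Fin n) (ZMod q) m :=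
  fun S => (M.randRun O coins fuel (encodeLWESamples S)).map fun o => o.getD false

/-! ### Peikert's `GapSVP_{ζ,γ}` -/

namespace GapSVPZeta

/-- The promise of Peikert's `GapSVP_{ζ,γ}` on an instance `(B, d)` of dimension `n`: `B` is
nonsingular, `λ₁(L(B)) ≤ ζ(n)`, every Gram–Schmidt vector of the given basis has norm `≥ 1`
(`minᵢ ‖b̃ᵢ‖ ≥ 1`), and `1 ≤ d ≤ ζ(n)/γ(n)`. [Peikert, *Public-key cryptosystems from the
worst-case shortest vector problem*, STOC 2009, §2–3, Definition of `GapSVP_{ζ,γ}` (?: exact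
placement of the promise re-checked against §3; the three extra conditions are as stated
there)] [cite: STOC2009, §2–3  Definition of  GapSVP_{ζ γ}  (?: e] -/
def Promise (ζ γ : ℕ → ℝ) (p : GapSVPInstance) : Prop :=
  p.1.IsNonsingular ∧ minNorm p.1.lattice ≤ ζ p.1.n ∧
    (∀ i, 1 ≤ ‖InnerProductSpace.gramSchmidt ℝ p.1.vec i‖) ∧
    1 ≤ (p.2 : ℝ) ∧ (p.2 : ℝ) ≤ ζ p.1.n / γ p.1.n

/-- YES instances of `GapSVP_{ζ,γ}`: the promise holds and `λ₁(L(B)) ≤ d`.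
[Peikert STOC 2009, §3 (?)] [cite: STOC2009, §3 (?] -/
def yes (ζ γ : ℕ → ℝ) : Set GapSVPInstance :=
  {p | Promise ζ γ p ∧ minNorm p.1.lattice ≤ (p.2 : ℝ)}

/-- NO instances of `GapSVP_{ζ,γ}`: the promise holds and `λ₁(L(B)) > γ(n) · d`.
[Peikert STOC 2009, §3 (?)] [cite: STOC2009, §3 (?] -/
def no (ζ γ : ℕ → ℝ) : Set GapSVPInstance :=
  {p | Promise ζ γ p ∧ γ p.1.n * (p.2 : ℝ) < minNorm p.1.lattice}

end GapSVPZeta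

/-- `GapSVP_{ζ,γ}` is a restriction of `GapSVP_γ`: its NO instances are NO instances of
`GapSVP_γ`. [Peikert STOC 2009, §3 ("GapSVP_{ζ,γ} is no harder than GapSVP_γ")] [cite: STOC2009, §3 ("GapSVP_{ζ γ} is no harder than GapS] -/
theorem gapSVPZeta_no_subset (ζ γ : ℕ → ℝ) : GapSVPZeta.no ζ γ ⊆ GapSVP.no γ := by
  rintro p ⟨⟨h1, -, -, h4, -⟩, h⟩
  exact ⟨h1, by exact_mod_cast one_pos.trans_le h4, h⟩

/-- `GapSVP_{ζ,γ}` is a restriction of `GapSVP_γ`: its YES instances are YES instances of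
`GapSVP_γ`. [Peikert STOC 2009, §3] [cite: STOC2009, §3] -/
theorem gapSVPZeta_yes_subset (ζ γ : ℕ → ℝ) : GapSVPZeta.yes ζ γ ⊆ GapSVP.yes γ := by
  rintro p ⟨⟨h1, -, -, h4, -⟩, h⟩
  exact ⟨h1, by exact_mod_cast one_pos.trans_le h4, h⟩

/-- For `γ ≥ 1` the YES and NO instances of `GapSVP_{ζ,γ}` are disjoint.
[Peikert STOC 2009, §3; from `Literature.Algebra.EuclideanLattices.gapSVP_disjoint`] [cite: STOC2009, §3] -/
theorem gapSVPZeta_disjoint {ζ γ : ℕ → ℝ} (hγ : ∀ n, 1 ≤ γ n) :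
    Disjoint (GapSVPZeta.yes ζ γ) (GapSVPZeta.no ζ γ) :=
  (gapSVP_disjoint hγ).mono (gapSVPZeta_yes_subset ζ γ) (gapSVPZeta_no_subset ζ γ)

/-! ### Growth conditions -/

/-- `IsSoftBigO γ f`: `γ = Õ(f)`, i.e. `γ =O[atTop] (f · (log ·)^k)` for some `k : ℕ`
(Mathlib `Asymptotics.IsBigO`). Used with `f n = n / α n` for Regev's `Õ(n/α)` approximation
factors. [Regev 2009, Thm 1.1 (`Õ(n/α)`); Arora–Barak 2009, §0.3 (`Õ`)] [cite: Regev2009, Thm 1.1 ( Õ(n/α] -/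
def IsSoftBigO (γ f : ℕ → ℝ) : Prop :=
  ∃ k : ℕ, γ =O[atTop] fun n => f n * Real.log n ^ k

/-- `O(f)` sequences are `Õ(f)` (`k = 0`). [Arora–Barak 2009, §0.3] [cite: AroraBarak2009, §0.3] -/
theorem IsSoftBigO.of_isBigO {γ f : ℕ → ℝ} (h : γ =O[atTop] f) : IsSoftBigO γ f :=
  ⟨0, by simpa using h⟩

/-! ### Efficiently computable parameter sequences -/

/-- LOCAL GLUE (uniformity hypothesis of the worst-case/average-case reductions).
`IsPolyTimeParams q α m`: the LWE parameters `(q, α, m)` are polynomial-time computable from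
`1ⁿ` — `q n` and `m n` in binary (G01 `PolyTimeComputable unaryEncodeNat encodeNat`), and `α`
is given by a rational sequence `a` with `1ⁿ ↦ encodeRat (a n)` polynomial-time computable.
This is implicit in Regev 2009 Thm 3.1, Peikert 2009 Thm 3.1 and BLPRS 2013 (the reduction,
a *uniform* machine given only a lattice instance of dimension `n`, must itself produce
`q n`, `m n` and sample `Ψ̄_{α n}` to form its LWE queries); without it a single uniform
reduction would be asked to handle parameter sequences it cannot compute. Since `encodeNat`
is binary, it also forces `q` to have polynomially many bits. [Regev 2009, §3 (proof of
Thm 3.1: "q, α are efficiently computable"); Arora–Barak 2009, §1.3] [cite: Regev2009, Thm 3.1  Peikert 2009 Thm 3.1 and BLPRS] -/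
def IsPolyTimeParams (q : ℕ → ℕ) (α : ℕ → ℝ) (m : ℕ → ℕ) : Prop :=
  PolyTimeComputable unaryEncodeNat encodeNat q ∧ PolyTimeComputable unaryEncodeNat encodeNat m ∧
    ∃ a : ℕ → ℚ, (∀ n, α n = a n) ∧ PolyTimeComputable unaryEncodeNat encodeRat a

/-! ### pqc.S01 / pqc.S02: LWE versus BQP -/

/-- OPEN CONJECTURE — **pqc.S01** (peak; `LWE ∉ BQP`, the quantum hardness of LWE; negation
form of summits/fw-lwe-bqp/SUMMIT.md). POSED, not proved, in Regev 2009, §1 (J. ACM 56(6),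
art. 34; arXiv:2401.03703, p. 4): "One might even conjecture that there is no quantum polynomial
time algorithm that approximates GapSVP (or SIVP) to within any polynomial factor. One can then
interpret the main theorem as saying that based on this conjecture, the LWE problem is hard. The
only evidence supporting this conjecture is that there are no known quantum algorithms for
lattice problems that outperform classical algorithms, even though this is probably one of the
most important open questions in the field of quantum computing." The only theorem there is the
quantum reduction Thm 1.1 (`GapSVP`/`SIVP` within `Õ(n/α)` ≤ `LWE_{q,Ψ̄_α}`, vendored as
`regev_lwe_to_sivp_quantum` / `regev_lwe_to_gapSVP_quantum`, pqc.S19), and the best known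
algorithm for LWE takes `2^{O(n)}` equations/time (ibid., p. 3). Registered OPEN statement, not
literature debt: no `LWENotInBQP_holds` is expected (defact verdict 2026-08-15, open-problem);
canonical copy: the conjecture leaf `Summit.PneNP.PneNP.LWENotInBQP`
(`Summits/PneNP/PneNP/Theorems/LWENotInBQP.lean`), over which the unfoldings `lweNotInBQP_iff`,
`lweInBQP_iff_not_lweNotInBQP` are stated in `LWEHardnessConsequences.lean`; this tagged duplicate
awaits deletion by the migration (the module docstring of `LWEHardnessProofs` and the PneNP
`Lattice` thesis mention the name).
STATEMENT. For every modulus `q`, noise rate `α` and `c₀` in Regev's regime (`q` polynomially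
bounded, `q n ≥ 2`, eventually `0 < α n`, `α n · q n ≥ 2√n` — the summit's WEAK inequality,
contrast with the strict `>` of Regev's Thm 1.1 in `pqc.S19` — and `1/α n ≤ n^{c₀}`), every
polynomially bounded number of samples `m`, and every polynomial-time uniform quantum circuit
family `Q` (G11), `Q` does NOT solve search-`LWE_{q(n), Ψ̄_{α(n)}}` from `m n` samples with
average-case success probability `≥ 2/3` for all large `n`; i.e. (`lweNotInBQP_iff`) its success
probability is `< 2/3` for infinitely many `n`.
[cite: Regev2009, §1 (arXiv:2401.03703 p. 4; conjecture posed)] [status: open] -/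
@[conjecture] def LWENotInBQP : Prop :=
  ∀ (q : ℕ → ℕ) (α : ℕ → ℝ) (c₀ : ℕ) (m : ℕ → ℕ) (h : RegevRegime q α c₀), IsPolyBounded m →
    haveI := h.neZero
    ∀ Q : UniformQCircuitFamily, ¬ SearchLWESolves q (fun n => discretizedGaussian (q n) (α n)) m
      (fun n => Q.searchLWESolver n (q n) (m n)) fun _ => 2 / 3

/-- OPEN CONJECTURE — **pqc.S02** (`LWE ∈ BQP` for some parameter family in Regev's polynomial
regime; summits/fw-lwe-bqp/SUMMIT.md). This is the NEGATION of the open conjecture `LWENotInBQP`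
(`lweInBQP_iff_not_lweNotInBQP`): exactly one of the two holds and neither is known. POSED as an
open question in Regev 2009, §1 (J. ACM 56(6), art. 34; arXiv:2401.03703, p. 4): "one could also
interpret our main theorem as a way to disprove this conjecture: if one finds an efficient
algorithm for LWE, then one also obtains a quantum algorithm for approximating worst-case lattice
problems. Such a result would be of tremendous importance on its own." It is NOT a theorem of
Regev 2009 (whose Thm 1.1 is the reduction `regev_lwe_to_sivp_quantum`, pqc.S19): no polynomial
time quantum (or classical) algorithm for LWE is known — the best known algorithm takes `2^{O(n)}`
equations/time (ibid., p. 3) — and Regev guesses the opposite direction (ibid., p. 4, footnote).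
Registered OPEN statement, not literature debt: no `LWEInBQP_holds` is expected (defact verdict
2026-08-15, open-problem); canonical copy: the conjecture leaf `Summit.PneNP.PneNP.LWEInBQP`
(`Summits/PneNP/PneNP/Theorems/LWEInBQP.lean`), over which `lweInBQP_iff_not_lweNotInBQP` is stated
in `LWEHardnessConsequences.lean`; this tagged duplicate awaits deletion by the migration.
STATEMENT. There are `q`, `α`, `c₀` in Regev's regime, a polynomially bounded `m` and a
polynomial-time uniform quantum circuit family (G11) solving search-`LWE_{q(n), Ψ̄_{α(n)}}` from
`m n` samples with average-case success probability `≥ 2/3` for all large `n`.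
[cite: Regev2009, §1 (arXiv:2401.03703 p. 4; open question)] [status: open] -/
@[conjecture] def LWEInBQP : Prop :=
  ∃ (q : ℕ → ℕ) (α : ℕ → ℝ) (c₀ : ℕ) (m : ℕ → ℕ) (h : RegevRegime q α c₀), IsPolyBounded m ∧
    haveI := h.neZero
    ∃ Q : UniformQCircuitFamily, SearchLWESolves q (fun n => discretizedGaussian (q n) (α n)) m
      (fun n => Q.searchLWESolver n (q n) (m n)) fun _ => 2 / 3

/-! ### pqc.S19: Regev's quantum reduction -/

section Regev

variable (q : ℕ → ℕ) [∀ n, NeZero (q n)] (α : ℕ → ℝ) (m : ℕ → ℕ)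

/-- **pqc.S19** (Regev 2009, Thm 1.1 / Thm 3.1, SIVP form). Let `q` be polynomially bounded and
`α(n) ∈ (0,1)` with `α(n) · q(n) > 2√n` (STRICT, as in Regev; contrast with the summit's `≥` in
`pqc.S01`) for all large `n`, and `m` polynomially bounded. If some polynomial-time uniform
quantum circuit family solves search-`LWE_{q,Ψ̄_α}` from `m n` samples with average-case success
probability `≥ 2/3` for all large `n`, then there is `γ ≥ 1` with `γ = Õ(n/α)` and a
polynomial-time uniform quantum circuit family which, on every nonsingular lattice instance
`B ∈ ℤⁿˣⁿ` of large dimension `n`, outputs (the code of) an `SIVP_γ` solution with probability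
`≥ 2/3`. Hypothesis `hpar : IsPolyTimeParams q α m` (parameters efficiently computable from
`1ⁿ`) is Regev's implicit uniformity assumption; it is what allows ONE uniform reduction to
form LWE queries for the given parameter sequence. [cite: Regev2009, Thm 1.1 / Thm 3.1  SIVP form] -/
def regev_lwe_to_sivp_quantum : Prop :=
  ∀ (hq : IsPolyBounded q) (hm : IsPolyBounded m) (hpar : IsPolyTimeParams q α m) (hα : ∀ᶠ n : ℕ in atTop, 0 < α n ∧ α n < 1 ∧ 2 * Real.sqrt n < α n * q n) (hLWE : ∃ Q : UniformQCircuitFamily, SearchLWESolves q (fun n => discretizedGaussian (q n) (α n)) m (fun n => Q.searchLWESolver n (q n) (m n)) fun _ => 2 / 3),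
    ∃ γ : ℕ → ℝ, (∀ n, 1 ≤ γ n) ∧ IsSoftBigO γ (fun n => n / α n) ∧
      ∃ Q : UniformQCircuitFamily, ∀ᶠ n in atTop, ∀ I : LatticeInstance, I.n = n →
        I.IsNonsingular →
          2 / 3 ≤ Q.kernelProb I.encode {w | SIVP.IsSolution γ I (decodeIntMatrix I.n w)}

/-- **pqc.S19** (Regev 2009, Thm 1.1 / Thm 3.1 with the SIVP-to-GapSVP remark of §1, GapSVP
form). Under the hypotheses of `regev_lwe_to_sivp_quantum`, there is `γ ≥ 1` with `γ = Õ(n/α)`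
and a polynomial-time uniform quantum circuit family deciding `GapSVP_γ` on every instance of
large dimension `n`: acceptance probability (G11 `acceptProbOn 0`, output wire `0`) `≥ 2/3` on
YES instances and `≤ 1/3` on NO instances, as in G11's `PromiseBQP`. [cite: Regev2009, Thm 1.1 / Thm 3.1 with the SIVP-to-GapSV] -/
def regev_lwe_to_gapSVP_quantum : Prop :=
  ∀ (hq : IsPolyBounded q) (hm : IsPolyBounded m) (hpar : IsPolyTimeParams q α m) (hα : ∀ᶠ n : ℕ in atTop, 0 < α n ∧ α n < 1 ∧ 2 * Real.sqrt n < α n * q n) (hLWE : ∃ Q : UniformQCircuitFamily, SearchLWESolves q (fun n => discretizedGaussian (q n) (α n)) m (fun n => Q.searchLWESolver n (q n) (m n)) fun _ => 2 / 3),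
    ∃ γ : ℕ → ℝ, (∀ n, 1 ≤ γ n) ∧ IsSoftBigO γ (fun n => n / α n) ∧
      ∃ Q : UniformQCircuitFamily, ∀ᶠ n in atTop, ∀ p : GapSVPInstance, p.1.n = n →
        (p ∈ GapSVP.yes γ → 2 / 3 ≤ Q.acceptProb p.encode) ∧
        (p ∈ GapSVP.no γ → Q.acceptProb p.encode ≤ 1 / 3)

end Regev

/-! ### pqc.S20 / pqc.S21: classical reductions (Peikert, BLPRS) -/

section ClassicalReductions

variable (q : ℕ → ℕ) [∀ n, NeZero (q n)] (α : ℕ → ℝ) (m : ℕ → ℕ)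

/-- **pqc.S20** (Peikert, *Public-key cryptosystems from the worst-case shortest vector
problem*, STOC 2009, Thm 3.1 (?: theorem number as in the inventory)). Let `α(n) ∈ (0,1)` for
all large `n` and `m` polynomially bounded. Then there is `γ ≥ 1` with `γ = Õ(n/α)` such that
for every `ζ ≥ γ` and every `f → ∞` with `q(n) ≥ ζ(n) · f(n) · √(log n) / √n` for all large `n`
(Peikert's `q ≥ ζ · ω(√(log n / n))`, one reduction per growth witness `f`; exponential `ζ`,
e.g. `q ≥ 2^{n/2}`-type moduli, is the inventory's case) there is a probabilistic
polynomial-time oracle algorithm `M` (coins `coins`, round budget `fuel`; G11 `randRun`) such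
that for EVERY oracle `O` solving search-`LWE_{q,Ψ̄_α}` from `m n`
samples with probability `≥ 2/3` (all large `n`), `M^O` decides Peikert's `GapSVP_{ζ,γ}` with
probability `≥ 2/3` on every instance of large dimension `n`: a classical worst-case to
average-case reduction. Hypothesis `hpar : IsPolyTimeParams q α m`: the parameters are
polynomial-time computable from `1ⁿ` (Peikert's implicit uniformity assumption; in particular
`q` — which need NOT be polynomially bounded here — has polynomially many bits, so LWE queries
are writable in poly(n) bits and `ζ ≤ q` is `2^{poly(n)}`); without it one uniform `M` would be
asked to serve non-computable parameter sequences. The lower bound `1 ≤ γ n` rules out the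
vacuous `γ = 0` (empty promise). Deterministic oracles: see `Oracle.searchLWEKernel`. [cite: STOC2009, Thm 3.1 (?: theorem number as in the inv] -/
def peikert_gapSVPZeta_to_lwe_classical : Prop :=
  ∀ (hpar : IsPolyTimeParams q α m) (hm : IsPolyBounded m) (hα : ∀ᶠ n : ℕ in atTop, 0 < α n ∧ α n < 1),
    ∃ γ : ℕ → ℝ, (∀ n, 1 ≤ γ n) ∧ IsSoftBigO γ (fun n => n / α n) ∧
      ∀ (ζ f : ℕ → ℝ), Tendsto f atTop atTop →
      (∀ᶠ n : ℕ in atTop, γ n ≤ ζ n ∧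
        ζ n * f n * Real.sqrt (Real.log n) / Real.sqrt n ≤ q n) →
      ∃ (M : OracleAlg Bool) (coins fuel : Polynomial ℕ), M.IsPolyTime encodingBoolBool ∧
        ∀ O : Oracle, O.SolvesSearchLWE q (fun n => discretizedGaussian (q n) (α n)) m (2 / 3) →
          ∀ᶠ n in atTop, ∀ p : GapSVPInstance, p.1.n = n →
            (p ∈ GapSVPZeta.yes ζ γ → 2 / 3 ≤ M.randRun O coins fuel p.encode (some true)) ∧
            (p ∈ GapSVPZeta.no ζ γ → 2 / 3 ≤ M.randRun O coins fuel p.encode (some false))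

/-- **pqc.S21** (Brakerski–Langlois–Peikert–Regev–Stehlé, STOC 2013, Thm 1.1 (?: informal main
theorem; the precise admissible noise range is that of their formal main theorem, §3–§4)). Let
`q` and `m` be polynomially bounded. Then there is an exponent `k` such that for every noise
rate `α` with `α(n) ∈ (0,1)` and `α(n) q(n) ≥ √n · (log n)^k` for all large `n`, there are
`γ ≥ 1` bounded by a polynomial and a probabilistic polynomial-time oracle algorithm `M` such
that for every oracle `O` solving `n`-dimensional search-`LWE_{q,Ψ̄_α}` from `m n` samples with
probability `≥ 2/3` (all large `n`), `M^O`, given `1ⁿ` and an instance of `GapSVP_γ` of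
dimension `⌊√n⌋`, decides it with probability `≥ 2/3` (all large `n`): `n`-dimensional LWE
with polynomial modulus (and inverse-polynomial noise rate) is classically at least as hard as
`√n`-dimensional `GapSVP`. (The polynomial bound on `γ` is the shared `IsPolyBoundedReal`.)
NOISE CONDITION RECORD (?): BLPRS's Thm 1.1 is informal ("poly(n) modulus"); their formal
chain — a Peikert-style classical reduction for `√n`-dimensional `GapSVP` to `√n`-dimensional
LWE with modulus `≥ 2^{√n/2}`, then modulus–dimension switching down to `q = poly(n)` in
dimension `n` through binary-secret LWE (BLPRS 2013, §3–§4) — carries an explicit lower bound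
on `αq` of the shape `√n` times logarithmic factors (exact form `?`). Rather than hard-coding a
possibly-too-weak constant (Regev's `2√n`), the statement quantifies that bound as
`∃ k, αq ≥ √n (log n)^k`, which every bound of that shape implies (constants are absorbed
eventually by one extra `log`); BLPRS's `Õ(·)` losses in the approximation factor are absorbed
by the existential polynomial `γ`. Every dimension `d` is reached at `n = d²`. The uniformity
hypothesis `IsPolyTimeParams q α m` (parameters poly-time computable from `1ⁿ`, implicit in
BLPRS) sits inside the `∀ α`. [cite: BLPRS2013, §3–§4] -/
def blprs_gapSVP_sqrt_dim_to_lwe_classical : Prop :=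
  ∀ (hq : IsPolyBounded q) (hm : IsPolyBounded m),
    ∃ k : ℕ, ∀ α : ℕ → ℝ, IsPolyTimeParams q α m →
      (∀ᶠ n : ℕ in atTop, 0 < α n ∧ α n < 1 ∧ Real.sqrt n * Real.log n ^ k ≤ α n * q n) →
    ∃ γ : ℕ → ℝ, (∀ n, 1 ≤ γ n) ∧ IsPolyBoundedReal γ ∧
      ∃ (M : OracleAlg Bool) (coins fuel : Polynomial ℕ), M.IsPolyTime encodingBoolBool ∧
        ∀ O : Oracle, O.SolvesSearchLWE q (fun n => discretizedGaussian (q n) (α n)) m (2 / 3) →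
          ∀ᶠ n in atTop, ∀ p : GapSVPInstance, p.1.n = Nat.sqrt n →
            (p ∈ GapSVP.yes γ → 2 / 3 ≤
              M.randRun O coins fuel (boolPair (unaryEncodeNat n) p.encode) (some true)) ∧
            (p ∈ GapSVP.no γ → 2 / 3 ≤
              M.randRun O coins fuel (boolPair (unaryEncodeNat n) p.encode) (some false))

end ClassicalReductions

/-! ### pqc.S22: search-to-decision equivalence -/

section SearchDecision

variable (q : ℕ → ℕ) [∀ n, NeZero (q n)]

/-- **pqc.S22** (Regev 2009, Lemma 4.2 with Lemma 4.1; decision ⇒ search for prime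
`q = poly(n)`). Let `q(n)` be prime for all large `n` (the instance `[∀ n, NeZero (q n)]` is
kept for the types `ZMod (q n)`; it is implied eventually by primality) and polynomially
bounded, `m` polynomially bounded and `χ` any noise. For all `c`, `c'` there are a
probabilistic polynomial-time oracle algorithm `M` and a polynomially bounded `m'` such that for
every oracle `O` whose decision-LWE distinguisher on `m n` samples has advantage `≥ 1/n^c` for
all large `n` (`DecisionLWEDistinguishes`), the solver `M^O` solves search-`LWE_{q,χ}` from
`m' n` samples with average-case success probability `≥ 1 - 1/n^{c'}` for all large `n`
(`SearchLWESolves`). Notes: `distinguishingAdvantage` (inside `DecisionLWEDistinguishes`,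
equivalently `Oracle.lweAdvantage`) is the AVERAGE-case (uniform `s`) advantage, whereas Regev's
Lemma 4.2 assumes a distinguisher for every `s` and Lemma 4.1 (average-case to worst-case)
bridges the two via a non-negligible fraction of `s`; the composite is stated here. The idiom
`∀ c, ∀ᶠ n, · ≤ 1/n^c` is T-CRYPTO's `Negligible` (Mathlib anchor
`Asymptotics.SuperpolynomialDecay`), to be substituted once shared. [cite: Regev2009, Lemma 4.2 with Lemma 4.1] -/
def regev_decision_to_search : Prop :=
  ∀ (χ : ∀ n, PMF (ZMod (q n))) (m : ℕ → ℕ) (hprime : ∀ᶠ n in atTop, (q n).Prime) (hq : IsPolyBounded q) (hm : IsPolyBounded m) (c c' : ℕ),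
    ∃ (M : OracleAlg (List Bool)) (coins fuel : Polynomial ℕ) (m' : ℕ → ℕ),
      M.IsPolyTime (encodingList Bool) ∧ IsPolyBounded m' ∧
        ∀ O : Oracle, DecisionLWEDistinguishes q χ m
            (fun n => O.lweDistinguisherKernel n (q n) (m n)) (fun n => 1 / (n : ℝ) ^ c) →
          SearchLWESolves q χ m' (fun n => oracleSearchLWESolver M O coins fuel n (q n) (m' n))
            fun n => 1 - 1 / (n : ℝ) ^ c'

/-- **pqc.S22** (search ⇒ decision, the easy direction; Regev 2009, §4). Let `q ≥ 2` be
polynomially bounded, `α(n) ∈ (0,1)` for all large `n` and `m` polynomially bounded. There are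
a probabilistic polynomial-time oracle algorithm `M`, a polynomially bounded `m'` and `c` such
that for every oracle `O` solving search-`LWE_{q,Ψ̄_α}` from `m n` samples with probability
`≥ 2/3` (all large `n`), the distinguisher `M^O` on `m' n` samples has decision-LWE advantage
`≥ 1/n^c` for all large `n` (run the solver on `m n` samples, then test the residuals
`b - ⟨a, s'⟩` of fresh samples for concentration). The constant advantage comes from `α n < 1`
and `q n ≥ 2`: `Ψ̄_α` on `ℤ_q` is then at statistical distance at least an absolute constant
from uniform (monotone in `α`); for `q = 1` LWE samples ARE uniform and the statement fails,
whence the eventual hypothesis `hq2`. No uniformity hypothesis on `(q, α)` is needed: `M`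
reads `n`, `q` off the self-describing sample header and never samples `Ψ̄_α`. [cite: Regev2009, §4] -/
def regev_search_to_decision : Prop :=
  ∀ (α : ℕ → ℝ) (m : ℕ → ℕ) (hq : IsPolyBounded q) (hq2 : ∀ᶠ n in atTop, 2 ≤ q n) (hm : IsPolyBounded m) (hα : ∀ᶠ n : ℕ in atTop, 0 < α n ∧ α n < 1),
    ∃ (M : OracleAlg Bool) (coins fuel : Polynomial ℕ) (m' : ℕ → ℕ) (c : ℕ),
      M.IsPolyTime encodingBoolBool ∧ IsPolyBounded m' ∧
        ∀ O : Oracle, O.SolvesSearchLWE q (fun n => discretizedGaussian (q n) (α n)) m (2 / 3) →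
          DecisionLWEDistinguishes q (fun n => discretizedGaussian (q n) (α n)) m'
            (fun n => oracleLWEDistinguisher M O coins fuel n (q n) (m' n))
            fun n => 1 / (n : ℝ) ^ c

end SearchDecision

end PQC

end Literature.Computability.Cryptography

end
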